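import Literature.AlgebraicGeometry.Resolution.ArithmeticalThreefoldsLocalChart
import Literature.AlgebraicGeometry.Resolution.ArithmeticalThreefoldsLocalInField
import Literature.AlgebraicGeometry.Resolution.ArithmeticalThreefoldsLocalReduction
import HarnessLib

/-!
# Cossart–Piltant's frame at the centre of `μ` after the first blowing up, assembled
# (arXiv v1 Prop. 2.7 + Prop. 2.10, in-field frames)

Topic: `Literature/AlgebraicGeometry/Resolution`. PROOF side of `CossartPiltant2019Local`
(`ArithmeticalThreefoldsLocal.lean`; Cossart–Piltant 2019, journal Thm. 1.5 = arXiv v1 Thm. 1.4).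
`ArithmeticalThreefoldsLocalInField.lean` fixes the type of a FRAME of the printed induction along
the local blowing ups of `μ` (v1 Thm. 1.4, §2.2): a subring `R ⊆ L` of the one field `L ∋ x`
carrying `O = 𝒪_μ`, an equation `h ∈ R[X]` with root `x`, (MIN), (GEN), case (i)/(ii) with
`Aut_R(L)`; `ArithmeticalThreefoldsLocalChart.lean` constructs the pieces of the next frame after
blowing up the closed point (v1 Prop. 2.7, Prop. 2.10). This file ASSEMBLES them:

* `dvd_of_min`, `min_inv_mul`, `exists_denominator_polynomial`, `min_of_subring_fractions`,
  `irreducible_map_of_min`, `adjoin_eq_top_of_gen` — bookkeeping for (MIN)/(GEN): (MIN) says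
  `(h) = ker(g ↦ g(x))`, is stable under `x ↦ x/c` and under enlarging the coefficient ring
  inside its fractions, and is equivalent to irreducibility of `h` over the fraction field;
  (GEN) gives `L = K(x)`;
* `exists_pow_mul_mem_of_mem_blowupRing`, `exists_mul_eq_of_mem_locAtCentre_blowupRing` — the
  quadratic transform `R₁ = (R[𝔪_R/c])_{𝔪_O ∩ R[𝔪_R/c]}` lies in the fractions of `R`;
* `natCard_algEquiv_eq_of_forall_apply_eq` — `|Aut_{R₁}(L)| = |Aut_R(L)|` when `R ≤ R₁` and
  every `R`-automorphism fixes `R₁`;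
* `exists_frame_quadraticTransform` — **the frame at the centre of `μ` after blowing up the
  closed point** (v1 Prop. 2.7 with Prop. 2.10, for a frame in normal form `f_i ∈ 𝔪_R^i`, i.e.
  `δ(x) ≥ 1`): a nonzero `c ∈ 𝔪_R` of minimal value, the quadratic transform `R₁` of `R` along
  `O` — regular, excellent, of residue characteristic `p`, dominated by `O` — and a monic
  `h₁ ∈ R₁[X]` of degree `p` with root `x₁ = x/c` and `c^{p-i}(h₁)_i = (h)_i`, satisfying (MIN),
  (GEN) and case (i)/(ii) again (for (ii): `Aut_{R₁}(L) = Aut_R(L)` leaves `R₁[x₁]` stable);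
* `subringDominates_of_forall_valuation_lt_one`, `maximalIdeal_ne_bot_of_ringKrullDim_ne_zero` —
  domination in the tree's `SubringDominates` form; `𝔪_R ≠ 0` for frames of nonzero dimension;
* `exists_regular_or_normalForm` — **normalisation at a frame** (v1 Prop. 2.10 first claims,
  pointwise form of `CossartPiltant2019Local.of_normalForm`, `ArithmeticalThreefoldsLocalReduction.lean`):
  either `R[x]` is already regular at the centre of `O`, or after a translation `x' = x - a`,
  `h' = h(X + a)` (`a ∈ R`; `R[x'][t] = R[x][t]`) the frame is in normal form
  `h' ≡ X^p mod 𝔪_R`, `h'(0) ∈ 𝔪_R²`, with (MIN), (GEN), (i)/(ii) preserved (the fraction field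
  needed by the fibre analysis is manufactured as `FractionRing R ⊆ L`);
* `CossartPiltant2019Local.inField_of_cases`, `CossartPiltant2019Local.of_inField_cases` —
  hence **`CossartPiltant2019Local` follows from the in-field statement in the two cases of
  Cor. 5.2**: `m(x) < p` (some `f_i ∉ 𝔪_R^i`; [CoP4] Main Thm. 1.3) and `m(x) = p` (all
  `f_i ∈ 𝔪_R^i`; Thm. 2.23 and the Projection Theorem 5.1 of the paper).

Not treated: the dimension count `dim R₁ = dim R (= 3)`, which holds for residually algebraic
`μ` (dimension formula, `LocalModels.lean`) and fails otherwise (lower-dimensional frames), and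
the termination invariants `(m, ω, κ)` of the printed induction. Everything is PROVED; no
definitions and no named facts are introduced.

## Sources

* V. Cossart, O. Piltant, J. Algebra 529 (2019) 268–535 = arXiv:1412.0868: Thm. 1.4 (arXiv v1
  p. 4), Prop. 2.7 (p. 14), Prop. 2.10 (pp. 15–16), Cor. 5.2 (p. 58). [CossartPiltant2019]
-/

noncomputable section

open IsLocalRing Polynomial

namespace Literature.AlgebraicGeometry.Resolution

universe u

/-! ## (MIN) and (GEN): bookkeeping -/

section MinGen

variable {L : Type u} [Field L]

/-- (MIN) says that `(h)` is the kernel of `g ↦ g(x)`: if no nonzero polynomial of degree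
`< deg h` vanishes at the root `x` of the monic `h`, then `h ∣ g` whenever `g(x) = 0`
(divide `g` by `h`). [folklore] -/
theorem dvd_of_min {A : Type*} [CommRing A] [Algebra A L] {h : A[X]} (hmon : h.Monic) {x : L}
    (hx : aeval x h = 0)
    (hmin : ∀ g : A[X], g.natDegree < h.natDegree → aeval x g = 0 → g = 0) {g : A[X]}
    (hg : aeval x g = 0) : h ∣ g := by
  by_cases h1 : h = 1
  · rw [h1]; exact one_dvd _
  have e := modByMonic_add_div g h
  have hr : aeval x (g %ₘ h) = 0 := by
    have e' := congrArg (aeval x) e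
    rw [map_add, map_mul, hx, zero_mul, add_zero, hg] at e'
    exact e'
  have h0 := hmin _ (natDegree_modByMonic_lt g hmon h1) hr
  rw [← e, h0, zero_add]
  exact dvd_mul_right _ _

/-- (MIN) is stable under `x ↦ c⁻¹x` for a non-zero-divisor `c` of the coefficient ring:
`g(c⁻¹x) = 0` gives `(g.scaleRoots c)(x) = 0`. [folklore] -/
theorem min_inv_mul {A : Type*} [CommRing A] [Algebra A L] {n : ℕ} {x : L}
    (hmin : ∀ g : A[X], g.natDegree < n → aeval x g = 0 → g = 0) {c : A}
    (hc : c ∈ nonZeroDivisors A) (hc0 : algebraMap A L c ≠ 0) :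
    ∀ g : A[X], g.natDegree < n → aeval ((algebraMap A L c)⁻¹ * x) g = 0 → g = 0 := by
  intro g hdeg hg
  have h1 : aeval x (g.scaleRoots c) = 0 := by
    have := scaleRoots_aeval_eq_zero (r := c) hg
    rwa [← mul_assoc, mul_inv_cancel₀ hc0, one_mul] at this
  have h2 : g.scaleRoots c = 0 := hmin _ (by rw [natDegree_scaleRoots]; exact hdeg) h1
  have h3 : g.support = ∅ := by rw [← support_scaleRoots_eq g hc, h2, support_zero]
  exact Polynomial.support_eq_empty.mp h3

/-- **Clearing denominators.** If every element of the subring `B ⊆ L` is a fraction of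
elements of the subring `A` (`b·d = a`, `a, d ∈ A`, `d ≠ 0`), then for every `g ∈ B[X]` there
are `0 ≠ d ∈ A` and `g' ∈ A[X]` with `g' = d·g` in `L[X]`. [folklore] -/
theorem exists_denominator_polynomial {A B : Subring L}
    (hAB : ∀ b : B, ∃ a d : A, (d : L) ≠ 0 ∧ (b : L) * d = a) (g : B[X]) :
    ∃ (d : A) (g' : A[X]), (d : L) ≠ 0 ∧
      g'.map (algebraMap A L) = (d : L) • g.map (algebraMap B L) := by
  induction g using Polynomial.induction_on' with
  | add g₁ g₂ ih₁ ih₂ =>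
    obtain ⟨d₁, g₁', hd₁, h₁⟩ := ih₁
    obtain ⟨d₂, g₂', hd₂, h₂⟩ := ih₂
    refine ⟨d₁ * d₂, C d₂ * g₁' + C d₁ * g₂', by rw [Subring.coe_mul]; exact mul_ne_zero hd₁ hd₂, ?_⟩
    rw [Polynomial.map_add, Polynomial.map_mul, Polynomial.map_mul, map_C, map_C, h₁, h₂,
      Polynomial.map_add, smul_add, Subring.coe_mul]
    change C (d₂ : L) * ((d₁ : L) • _) + C (d₁ : L) * ((d₂ : L) • _) = _
    rw [smul_eq_C_mul, smul_eq_C_mul, smul_eq_C_mul, smul_eq_C_mul, C_mul]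
    ring
  | monomial k b =>
    obtain ⟨a, d, hd, hbd⟩ := hAB b
    refine ⟨d, monomial k a, hd, ?_⟩
    rw [map_monomial, map_monomial, smul_monomial, smul_eq_mul, mul_comm]
    change monomial k (a : L) = monomial k ((b : L) * d)
    rw [hbd]

/-- **(MIN) passes to a larger coefficient ring inside the fractions**: if every element of `B`
is a fraction of elements of `A ≤ B` and no nonzero `g ∈ A[X]` of degree `< n` has `g(y) = 0`,
then no nonzero `g ∈ B[X]` of degree `< n` has `g(y) = 0` (clear denominators). [folklore] -/
theorem min_of_subring_fractions {A B : Subring L}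
    (hAB : ∀ b : B, ∃ a d : A, (d : L) ≠ 0 ∧ (b : L) * d = a) {n : ℕ} {y : L}
    (hmin : ∀ g : A[X], g.natDegree < n → aeval y g = 0 → g = 0) :
    ∀ g : B[X], g.natDegree < n → aeval y g = 0 → g = 0 := by
  intro g hdeg hg
  obtain ⟨d, g', hd, hg'⟩ := exists_denominator_polynomial hAB g
  have hinjA : Function.Injective (algebraMap A L) := Subtype.val_injective
  have hinjB : Function.Injective (algebraMap B L) := Subtype.val_injective
  have hg'y : aeval y g' = 0 := by
    rw [← aeval_map_algebraMap L y g', hg', map_smul, aeval_map_algebraMap, hg, smul_zero]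
  have hg'deg : g'.natDegree < n := by
    rw [← natDegree_map_eq_of_injective hinjA, hg']
    refine lt_of_le_of_lt (natDegree_smul_le _ _) ?_
    rw [natDegree_map_eq_of_injective hinjB]
    exact hdeg
  have h0 := hmin g' hg'deg hg'y
  rw [h0, Polynomial.map_zero, eq_comm, smul_eq_zero] at hg'
  rcases hg' with h1 | h1
  · exact absurd h1 hd
  · exact (Polynomial.map_eq_zero_iff hinjB).mp h1

/-- **(MIN) ⇒ irreducibility over the fraction field**: for `S ⊆ L` a domain with fraction
field `K ⊆ L`, a monic `h ∈ S[X]` with a root `x ∈ L` at which no nonzero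
`g ∈ S[X]` of smaller degree vanishes is irreducible over `K` (`h ↦ K[X]` is the minimal
polynomial of `x`: a smaller one would clear to a smaller `g ∈ S[X]`). [folklore] -/
theorem irreducible_map_of_min {S K : Type u} [CommRing S] [IsDomain S] [Field K] [Algebra S K]
    [IsFractionRing S K] [Algebra K L] [Algebra S L] [IsScalarTower S K L] {h : S[X]}
    (hmon : h.Monic) {x : L} (hx : aeval x h = 0)
    (hmin : ∀ g : S[X], g.natDegree < h.natDegree → aeval x g = 0 → g = 0) :
    Irreducible (h.map (algebraMap S K)) := by
  have hxK : aeval x (h.map (algebraMap S K)) = 0 := by rwa [aeval_map_algebraMap]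
  have hint : IsIntegral K x := ⟨_, hmon.map _, by rwa [← aeval_def]⟩
  -- `deg minpoly ≥ deg h`
  have hle : h.natDegree ≤ (minpoly K x).natDegree := by
    by_contra hlt
    rw [not_le] at hlt
    set q := minpoly K x
    obtain ⟨b, hbM, hb⟩ := IsLocalization.integerNormalization_spec (nonZeroDivisors S) q
    set g := IsLocalization.integerNormalization (nonZeroDivisors S) q
    have hb0 : algebraMap S K b ≠ 0 :=
      IsFractionRing.to_map_ne_zero_of_mem_nonZeroDivisors hbM
    have hgq : g.natDegree = q.natDegree := by
      rw [← natDegree_map_eq_of_injective (IsFractionRing.injective S K), hb,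
        ← algebraMap_smul K b q, smul_eq_C_mul, natDegree_C_mul hb0]
    have hgx : aeval x g = 0 := by
      rw [← aeval_map_algebraMap K x g, hb, ← algebraMap_smul K b q, map_smul, minpoly.aeval,
        smul_zero]
    have hg0 := hmin g (hgq ▸ hlt) hgx
    have : q = 0 := by
      have h1 : (algebraMap S K b) • q = 0 := by
        rw [algebraMap_smul, ← hb, hg0, Polynomial.map_zero]
      exact (smul_eq_zero.mp h1).resolve_left hb0
    exact minpoly.ne_zero hint this
  have heq : h.map (algebraMap S K) = minpoly K x :=
    eq_of_monic_of_dvd_of_natDegree_le (minpoly.monic hint) (hmon.map _)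
      (minpoly.dvd K x hxK) (by rwa [hmon.natDegree_map])
  rw [heq]
  exact minpoly.irreducible hint

/-- **(GEN) ⇒ `L = K(x)`**: if every `z ∈ L` has `z·s = g(x)` with `g ∈ S[X]`, `0 ≠ s ∈ S`,
then `L` is generated by `x` over the fraction field `K` of `S`. [folklore] -/
theorem adjoin_eq_top_of_gen {S K : Type u} [CommRing S] [IsDomain S] [Field K] [Algebra S K]
    [IsFractionRing S K] [Algebra K L] [Algebra S L] [IsScalarTower S K L] {x : L}
    (hgen : ∀ z : L, ∃ (g : S[X]) (s : S), s ≠ 0 ∧ z * algebraMap S L s = aeval x g) :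
    Algebra.adjoin K ({x} : Set L) = ⊤ := by
  rw [eq_top_iff]
  intro z _
  obtain ⟨g, s, hs, hz⟩ := hgen z
  have hs0 : algebraMap S L s ≠ 0 := by
    rw [IsScalarTower.algebraMap_apply S K L]
    exact (_root_.map_ne_zero _).mpr (IsFractionRing.to_map_ne_zero_of_mem_nonZeroDivisors
      (mem_nonZeroDivisors_of_ne_zero hs))
  have hz' : z = (algebraMap K L (algebraMap S K s)⁻¹) * aeval x (g.map (algebraMap S K)) := by
    rw [aeval_map_algebraMap, ← hz, map_inv₀, ← IsScalarTower.algebraMap_apply, mul_comm,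
      mul_assoc, mul_inv_cancel₀ hs0, mul_one]
  rw [hz']
  refine Subalgebra.mul_mem _ (Subalgebra.algebraMap_mem _ _) ?_
  rw [Algebra.adjoin_singleton_eq_range_aeval]
  exact ⟨_, rfl⟩

end MinGen

/-! ## The quadratic transform lies in the fractions of `R` -/

section Fractions

variable {L : Type u} [Field L] (O : ValuationSubring L) {R : Subring L} [IsLocalRing R]

/-- Every element of `R[𝔪_R/c]` becomes an element of `R` after multiplication by a power of
`c`. [folklore] -/
theorem exists_pow_mul_mem_of_mem_blowupRing {c : R} (hc0 : (c : L) ≠ 0) {y : L}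
    (hy : y ∈ blowupRing R (c : L)) : ∃ (N : ℕ) (r : R), y * (c : L) ^ N = r := by
  induction hy using Subring.closure_induction with
  | mem y hy =>
    rcases hy with hy | ⟨y, -, rfl⟩
    · exact ⟨0, ⟨y, hy⟩, by rw [pow_zero, mul_one]⟩
    · exact ⟨1, y, by rw [pow_one, div_mul_cancel₀ _ hc0]⟩
  | zero => exact ⟨0, 0, by simp⟩
  | one => exact ⟨0, 1, by simp⟩
  | add y z _ _ hy hz =>
    obtain ⟨N, r, hr⟩ := hy
    obtain ⟨M, s, hs⟩ := hz
    refine ⟨N + M, r * c ^ M + s * c ^ N, ?_⟩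
    rw [Subring.coe_add, Subring.coe_mul, Subring.coe_mul, Subring.coe_pow, Subring.coe_pow,
      ← hr, ← hs]
    ring
  | neg y _ hy =>
    obtain ⟨N, r, hr⟩ := hy
    exact ⟨N, -r, by rw [Subring.coe_neg, ← hr]; ring⟩
  | mul y z _ _ hy hz =>
    obtain ⟨N, r, hr⟩ := hy
    obtain ⟨M, s, hs⟩ := hz
    refine ⟨N + M, r * s, ?_⟩
    rw [Subring.coe_mul, ← hr, ← hs]
    ring

/-- **The quadratic transform lies in the fractions of `R`**: every element `b` of
`(R[𝔪_R/c])_{𝔪_O ∩ R[𝔪_R/c]}` satisfies `b·d = a` for some `a, d ∈ R`, `d ≠ 0`. [folklore] -/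
theorem exists_mul_eq_of_mem_locAtCentre_blowupRing {c : R} (hc0 : (c : L) ≠ 0)
    (b : locAtCentre (blowupRing R (c : L)) O) :
    ∃ a d : R, (d : L) ≠ 0 ∧ (b : L) * d = a := by
  obtain ⟨y, hy, z, hz, hvz, hb⟩ := (mem_locAtCentre_iff).mp b.2
  obtain ⟨N, r, hr⟩ := exists_pow_mul_mem_of_mem_blowupRing hc0 hy
  obtain ⟨M, s, hs⟩ := exists_pow_mul_mem_of_mem_blowupRing hc0 hz
  have hz0 : z ≠ 0 := ne_zero_of_valuation_eq_one hvz
  refine ⟨r * c ^ M, s * c ^ N, ?_, ?_⟩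
  · rw [Subring.coe_mul, Subring.coe_pow, ← hs]
    exact mul_ne_zero (mul_ne_zero hz0 (pow_ne_zero _ hc0)) (pow_ne_zero _ hc0)
  · rw [Subring.coe_mul, Subring.coe_mul, Subring.coe_pow, Subring.coe_pow, ← hr, ← hs, hb]
    field_simp

end Fractions

/-! ## Automorphisms over `R` and over `R₁` -/

section Aut

variable {L : Type u} [Field L]

/-- **`|Aut_{R₁}(L)| = |Aut_R(L)|`** for subrings `R ≤ R₁ ⊆ L` such that every automorphism
of `L` over `R` fixes `R₁` pointwise (e.g. `R₁` inside the fractions of `R`). [folklore] -/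
theorem natCard_algEquiv_eq_of_forall_apply_eq {R R₁ : Subring L} (hle : R ≤ R₁)
    (hfix : ∀ σ : L ≃ₐ[R] L, ∀ r : R₁, σ r = r) :
    Nat.card (L ≃ₐ[R₁] L) = Nat.card (L ≃ₐ[R] L) := by
  refine Nat.card_eq_of_bijective
    (fun τ : L ≃ₐ[R₁] L => ({ τ.toRingEquiv with commutes' := fun r => τ.commutes ⟨r, hle r.2⟩ } :
      L ≃ₐ[R] L)) ⟨?_, ?_⟩
  · intro τ₁ τ₂ h12
    ext y
    exact congrArg (fun φ : L ≃ₐ[R] L => φ y) h12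
  · intro σ
    exact ⟨{ σ.toRingEquiv with commutes' := fun r => hfix σ r }, by ext; rfl⟩

end Aut

/-! ## The frame at the centre of `μ` after blowing up the closed point -/

section FrameStep

variable {L : Type u} [Field L] (O : ValuationSubring L) {R : Subring L}

/-- Domination `R ⊆ O`, `𝔪_O ∩ R ⊇ 𝔪_R` is the tree's `SubringDominates R O` (units of `R`
have value `1`). [folklore] -/
theorem subringDominates_of_forall_valuation_lt_one [IsLocalRing R] (hRO : R ≤ O.toSubring)
    (hdom : ∀ r : R, r ∈ maximalIdeal R → O.valuation (r : L) < 1) :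
    SubringDominates R O.toSubring := by
  refine (subringDominates_valuationSubring_iff hRO).mpr fun a => ⟨hdom a, fun hlt => ?_⟩
  by_contra hna
  have hu : IsUnit a := by
    by_contra hnu
    exact hna ((mem_maximalIdeal a).mpr (mem_nonunits_iff.mpr hnu))
  obtain ⟨b, hab⟩ := hu.exists_right_inv
  have h1 : O.valuation (a : L) = 1 :=
    valuation_eq_one_of_mul_eq_one O (hRO a.2) (hRO b.2) (by rw [← Subring.coe_mul, hab]; rfl)
  rw [h1] at hlt
  exact lt_irrefl _ hlt

/-- A local ring of nonzero Krull dimension has nonzero maximal ideal (the hypothesis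
`𝔪_R ≠ 0` of `exists_frame_quadraticTransform` for the three-dimensional frames). [folklore] -/
theorem maximalIdeal_ne_bot_of_ringKrullDim_ne_zero {A : Type*} [CommRing A] [IsLocalRing A]
    (h : ringKrullDim A ≠ 0) : maximalIdeal A ≠ ⊥ := fun hbot =>
  h (ringKrullDim_eq_zero_of_isField (IsLocalRing.isField_iff_maximalIdeal_eq.mpr hbot))

/-- **The frame at the centre of `μ` after blowing up the closed point** (Cossart–Piltant,
arXiv v1 Prop. 2.7 with Prop. 2.10, assembled from `ArithmeticalThreefoldsLocalChart.lean`). Let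
`R ⊆ L` be a regular local subring, excellent, with residue characteristic `p` and
`𝔪_R ≠ 0`, dominated by the valuation ring `O` of `L`; let `h ∈ R[X]` be monic of prime degree
`p` with root `x ∈ L`, satisfying (MIN), (GEN), case (i) or (ii) (as in
`CossartPiltant2019Local.of_inField`) and the NORMAL FORM `(h)_i ∈ 𝔪_R^{p-i}` (`f_i ∈ 𝔪_R^i`,
`δ(x) ≥ 1`). Then for some nonzero `c ∈ 𝔪_R` (of minimal value) the quadratic transform `R₁`
of `R` along `O` — a regular local subring `R ≤ R₁ ⊆ O`, excellent, of residue characteristic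
`p`, dominated by `O` — carries a monic `h₁ ∈ R₁[X]` of degree `p` with `c^{p-i}(h₁)_i = (h)_i`
and root `x₁ = c⁻¹x`, satisfying (MIN), (GEN) and case (i), resp. (ii), again. (The dimension
of `R₁` is NOT asserted: it equals that of `R` for residually algebraic `μ` only.)
[cite: CossartPiltant2019, Prop. 2.7 and Prop. 2.10 (arXiv v1, pp. 14–16)] -/
theorem exists_frame_quadraticTransform [IsRegularLocalRing R] {p : ℕ} (hp : p.Prime)
    (hexc : IsExcellentRing R) (hchar : CharP (ResidueField R) p) (hm : maximalIdeal R ≠ ⊥)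
    (hRO : R ≤ O.toSubring) (hdom : ∀ r : R, r ∈ maximalIdeal R → O.valuation (r : L) < 1)
    {h : R[X]} (hmon : h.Monic) (hdeg : h.natDegree = p) {x : L} (hx : aeval x h = 0)
    (hmin : ∀ g : R[X], g.natDegree < p → aeval x g = 0 → g = 0)
    (hgen : ∀ z : L, ∃ (g : R[X]) (s : R), s ≠ 0 ∧ z * s = aeval x g)
    (hcase : (CharP L p ∧ ∀ i, 0 < i → i < p → h.coeff i = 0) ∨
      (Nat.card (L ≃ₐ[R] L) = p ∧
        ∀ σ : L ≃ₐ[R] L, ∀ y ∈ Algebra.adjoin R ({x} : Set L), σ y ∈ Algebra.adjoin R ({x} : Set L)))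
    (hnf : ∀ i < p, h.coeff i ∈ maximalIdeal R ^ (p - i)) :
    ∃ (c : R) (R₁ : Subring L) (_ : IsRegularLocalRing R₁) (h₁ : R₁[X]),
      c ∈ maximalIdeal R ∧ (c : L) ≠ 0 ∧ IsQuadraticTransformAlong O R R₁ ∧ R ≤ R₁ ∧
      R₁ ≤ O.toSubring ∧ (∀ r : R₁, r ∈ maximalIdeal R₁ → O.valuation (r : L) < 1) ∧
      IsExcellentRing R₁ ∧ CharP (ResidueField R₁) p ∧
      h₁.Monic ∧ h₁.natDegree = p ∧ aeval ((c : L)⁻¹ * x) h₁ = 0 ∧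
      (∀ i, (h₁.coeff i : L) * (c : L) ^ (p - i) = h.coeff i) ∧
      (∀ g : R₁[X], g.natDegree < p → aeval ((c : L)⁻¹ * x) g = 0 → g = 0) ∧
      (∀ z : L, ∃ (g : R₁[X]) (s : R₁), s ≠ 0 ∧ z * s = aeval ((c : L)⁻¹ * x) g) ∧
      ((CharP L p ∧ ∀ i, 0 < i → i < p → h₁.coeff i = 0) ∨
        (Nat.card (L ≃ₐ[R₁] L) = p ∧
          ∀ σ : L ≃ₐ[R₁] L, ∀ y ∈ Algebra.adjoin R₁ ({(c : L)⁻¹ * x} : Set L),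
            σ y ∈ Algebra.adjoin R₁ ({(c : L)⁻¹ * x} : Set L))) := by
  classical
  -- the chart `c` and the quadratic transform `R₁`
  obtain ⟨c, hcm, hc0, hmax⟩ := exists_max_valuation_maximalIdeal O hRO hm
  have hq := isQuadraticTransformAlong_of_max O hRO hcm hc0 hmax
  set R₁ : Subring L := locAtCentre (blowupRing R (c : L)) O with hR₁
  haveI hreg₁ : IsRegularLocalRing R₁ := hq.isRegularLocalRing_of_isRegularLocalRing inferInstance
  have hRR₁ : R ≤ R₁ := hq.le
  have hR₁O : R₁ ≤ O.toSubring := hq.target_le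
  have hBR₁ : blowupRing R (c : L) ≤ R₁ := le_locAtCentre _ O
  have hdomR : SubringDominates R O.toSubring := subringDominates_of_forall_valuation_lt_one O hRO hdom
  have hdom₁ : ∀ r : R₁, r ∈ maximalIdeal R₁ → O.valuation (r : L) < 1 :=
    fun r hr => ((subringDominates_valuationSubring_iff hR₁O).mp hq.dominated r).mp hr
  -- excellence (transport along the finite presentation of `R[𝔪_R/c]`)
  have hexc₁ : IsExcellentRing R₁ := by
    obtain ⟨u, hu⟩ := (isNoetherianRing_iff_ideal_fg R).mp inferInstance (maximalIdeal R)
    have hB : blowupRing R (c : L) =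
        Subring.closure ((R : Set L) ∪ ↑(u.image fun y : R => (y : L) / c)) := by
      rw [blowupRing_eq_closure_of_span_eq (c : L) (↑u) hu, Finset.coe_image]
    have e : locAtCentre (Subring.closure ((R : Set L) ∪ ↑(u.image fun y : R => (y : L) / c))) O =
        R₁ := by rw [hR₁, hB]
    exact (isExcellentRing_locAtCentre_closure O _ hexc).of_ringEquiv (RingEquiv.subringCongr e)
  -- residue characteristic
  haveI := hchar
  have hchar₁ : CharP (ResidueField R₁) p :=
    charP_residueField_of_subringDominates ((hq.isQuadraticTransform hdomR).dominates) p
  -- the transformed equation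
  have hnf' : ∀ i < h.natDegree, h.coeff i ∈ maximalIdeal R ^ (h.natDegree - i) := by
    rw [hdeg]; exact hnf
  obtain ⟨h₁, hmon₁, hdeg₁, -, hcoe, hx₁⟩ := exists_transform hc0 hmon hnf' hx hBR₁
  have hdegP : h₁.natDegree = p := hdeg₁.trans hdeg
  have hcoeP : ∀ i, (h₁.coeff i : L) * (c : L) ^ (p - i) = h.coeff i := fun i => by
    rw [← hdeg]; exact hcoe i
  -- (MIN) for `(R₁, x₁)`
  have hcR : c ∈ nonZeroDivisors R :=
    mem_nonZeroDivisors_of_ne_zero fun h0 => hc0 (by rw [h0]; rfl)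
  have hminR : ∀ g : R[X], g.natDegree < p → aeval ((c : L)⁻¹ * x) g = 0 → g = 0 :=
    min_inv_mul hmin hcR hc0
  have hmin₁ : ∀ g : R₁[X], g.natDegree < p → aeval ((c : L)⁻¹ * x) g = 0 → g = 0 :=
    min_of_subring_fractions (A := R) (B := R₁)
      (fun b => exists_mul_eq_of_mem_locAtCentre_blowupRing O hc0 b) hminR
  -- (GEN) for `(R₁, x₁)`
  have hgen₁ : ∀ z : L, ∃ (g : R₁[X]) (s : R₁), s ≠ 0 ∧ z * s = aeval ((c : L)⁻¹ * x) g := by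
    intro z
    obtain ⟨g, s, hs, hz⟩ := hgen z
    refine ⟨(g.comp (C c * X)).map (Subring.inclusion hRR₁), ⟨s, hRR₁ s.2⟩,
      fun h0 => hs (Subtype.ext (congrArg (Subtype.val : R₁ → L) h0)), ?_⟩
    have e1 : (algebraMap R₁ L).comp (Subring.inclusion hRR₁) = algebraMap R L :=
      RingHom.ext fun _ => rfl
    rw [aeval_def, eval₂_map, e1, ← aeval_def, aeval_comp, map_mul, aeval_C, aeval_X,
      ← mul_assoc, show algebraMap R L c = (c : L) from rfl, mul_inv_cancel₀ hc0, one_mul, ← hz]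
  -- case (i) / (ii) for `(R₁, h₁, x₁)`
  have hcase₁ : (CharP L p ∧ ∀ i, 0 < i → i < p → h₁.coeff i = 0) ∨
      (Nat.card (L ≃ₐ[R₁] L) = p ∧
        ∀ σ : L ≃ₐ[R₁] L, ∀ y ∈ Algebra.adjoin R₁ ({(c : L)⁻¹ * x} : Set L),
          σ y ∈ Algebra.adjoin R₁ ({(c : L)⁻¹ * x} : Set L)) := by
    rcases hcase with ⟨hL, hzero⟩ | ⟨hcard, hstab⟩
    · refine Or.inl ⟨hL, fun i hi0 hip => ?_⟩
      refine transform_coeff_eq_zero hc0 hcoe (fun j hj0 hjp => hzero j hj0 ?_) i hi0 ?_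
      · rwa [hdeg] at hjp
      · rwa [hdeg]
    · right
      have hfix : ∀ σ : L ≃ₐ[R] L, ∀ r : R₁, σ r = r := fun σ r =>
        ringHom_apply_eq_self_of_mem_locAtCentre_blowupRing O σ.toRingEquiv.toRingHom
          (fun r => σ.commutes r) c r.2
      refine ⟨by rw [natCard_algEquiv_eq_of_forall_apply_eq hRR₁ hfix, hcard], fun τ => ?_⟩
      have hm0 : 0 < h.natDegree := by rw [hdeg]; exact hp.pos
      have hcoef : ∀ i < h.natDegree, h.coeff i ∈ maximalIdeal R := fun i hi =>
        Ideal.pow_le_self (Nat.sub_ne_zero_of_lt hi) (hnf' i hi)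
      have hdvd : ∀ g : R[X], aeval x g = 0 → h ∣ g := fun g hg =>
        dvd_of_min hmon hx (fun g hg' => hmin g (hdeg ▸ hg')) hg
      have hcR₁ : ∀ y ∈ maximalIdeal R, (y : L) / c ∈ R₁ := fun y hy =>
        hBR₁ (div_mem_blowupRing _ hy)
      let τ' : L ≃ₐ[R] L := { τ.toRingEquiv with commutes' := fun r => τ.commutes ⟨r, hRR₁ r.2⟩ }
      exact adjoin_transform_stable_of_stable hmon hm0 hcoef hx hdvd hc0 hRR₁ hcR₁
        τ.toRingEquiv.toRingHom (fun r => τ.commutes r) (fun y hy => hstab τ' y hy)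
  exact ⟨c, R₁, hreg₁, h₁, hcm, hc0, hq, hRR₁, hR₁O, hdom₁, hexc₁, hchar₁, hmon₁, hdegP, hx₁,
    hcoeP, hmin₁, hgen₁, hcase₁⟩

end FrameStep

/-! ## Normalisation at a frame (Prop. 2.10, pointwise) -/

section Normalize

variable {L : Type u} [Field L] (O : ValuationSubring L) {R : Subring L}

/-- **Normalisation at a frame** (pointwise form of `CossartPiltant2019Local.of_normalForm`;
Cossart–Piltant, arXiv v1 Prop. 2.10 first claims with Ch. 2 p. 9). For an in-field frame
`(R, h, x)` (regular local `R ⊆ O` dominated by `O`, residue characteristic `p`, `h ∈ R[X]`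
monic of prime degree `p` with root `x`, (MIN), (GEN), case (i)/(ii)): EITHER the model `R[x]`
is already regular at the centre of `O` (conclusion with `t = ∅`), OR for some `a ∈ R` the
translated frame `x' = x - a`, `h' = h(X + a)` — same model `R[x'][t] = R[x][t]`, (MIN), (GEN),
(i)/(ii) preserved — is in NORMAL FORM: `h' ≡ X^p mod 𝔪_R[X]` (the centre is the rational
point `X' = 0` of the fibre, Prop. 2.10: `η⁻¹(s) = {x}`, `k(x) = k(s)`) and `h'(0) ∈ 𝔪_R²` (the
centre is a singular point). The fraction field `K = Frac R ⊆ L` needed by the fibre analysis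
(`ArithmeticalThreefoldsLocalFibre.lean`, `ArithmeticalThreefoldsLocalReduction.lean`) is
manufactured from (MIN)/(GEN) (`irreducible_map_of_min`, `adjoin_eq_top_of_gen`).
[cite: CossartPiltant2019, Prop. 2.10 (arXiv v1 pp. 15–16) and Ch. 2 (v1 p. 9)] -/
theorem exists_regular_or_normalForm [IsRegularLocalRing R] {p : ℕ} (hp : p.Prime)
    (hchar : CharP (ResidueField R) p)
    (hRO : R ≤ O.toSubring) (hdom : ∀ r : R, r ∈ maximalIdeal R → O.valuation (r : L) < 1)
    {h : R[X]} (hmon : h.Monic) (hdeg : h.natDegree = p) {x : L} (hx : aeval x h = 0)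
    (hmin : ∀ g : R[X], g.natDegree < p → aeval x g = 0 → g = 0)
    (hgen : ∀ z : L, ∃ (g : R[X]) (s : R), s ≠ 0 ∧ z * s = aeval x g)
    (hcase : (CharP L p ∧ ∀ i, 0 < i → i < p → h.coeff i = 0) ∨
      (Nat.card (L ≃ₐ[R] L) = p ∧
        ∀ σ : L ≃ₐ[R] L, ∀ y ∈ Algebra.adjoin R ({x} : Set L), σ y ∈ Algebra.adjoin R ({x} : Set L))) :
    (∃ (t : Finset L) (ht : (Algebra.adjoin R (insert x (t : Set L))).toSubring ≤ O.toSubring),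
      IsRegularLocalRing (Localization.AtPrime
        (Ideal.comap (Subring.inclusion ht) (maximalIdeal O)))) ∨
    ∃ a : R, (h.comp (X + C a)).Monic ∧ (h.comp (X + C a)).natDegree = p ∧
      aeval (x - (a : L)) (h.comp (X + C a)) = 0 ∧
      (∀ g : R[X], g.natDegree < p → aeval (x - (a : L)) g = 0 → g = 0) ∧
      (∀ z : L, ∃ (g : R[X]) (s : R), s ≠ 0 ∧ z * s = aeval (x - (a : L)) g) ∧
      ((CharP L p ∧ ∀ i, 0 < i → i < p → (h.comp (X + C a)).coeff i = 0) ∨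
        (Nat.card (L ≃ₐ[R] L) = p ∧
          ∀ σ : L ≃ₐ[R] L, ∀ y ∈ Algebra.adjoin R ({x - (a : L)} : Set L),
            σ y ∈ Algebra.adjoin R ({x - (a : L)} : Set L))) ∧
      (∀ i < p, (h.comp (X + C a)).coeff i ∈ maximalIdeal R) ∧
      (h.comp (X + C a)).coeff 0 ∈ maximalIdeal R ^ 2 ∧
      (∀ t : Set L, Algebra.adjoin R (insert (x - (a : L)) t) = Algebra.adjoin R (insert x t)) := by
  classical
  haveI : Fact p.Prime := ⟨hp⟩
  haveI := hchar
  -- manufacture the fraction field `K ⊆ L`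
  let K := FractionRing R
  have hinj : Function.Injective (algebraMap R L) := Subtype.val_injective
  letI : Algebra K L := (IsFractionRing.lift hinj : K →+* L).toAlgebra
  haveI : IsScalarTower R K L :=
    IsScalarTower.of_algebraMap_eq fun r => (IsFractionRing.lift_algebraMap hinj r).symm
  have hirr : Irreducible (h.map (algebraMap R K)) :=
    irreducible_map_of_min hmon hx (by rw [hdeg]; exact hmin)
  have hKx : Algebra.adjoin K ({x} : Set L) = ⊤ := adjoin_eq_top_of_gen (S := R) (K := K) hgen
  have hG : (CharP K p ∧ ∀ i, 0 < i → i < p → h.coeff i = 0) ∨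
      (Nat.card (L ≃ₐ[K] L) = p ∧
        ∀ σ : L ≃ₐ[K] L, ∀ y ∈ Algebra.adjoin R ({x} : Set L), σ y ∈ Algebra.adjoin R ({x} : Set L)) := by
    rcases hcase with ⟨hL, hz⟩ | ⟨hcard, hstab⟩
    · haveI := hL
      exact Or.inl ⟨(RingHom.charP_iff_charP (algebraMap K L) p).mpr hL, hz⟩
    · refine Or.inr ⟨?_, ?_⟩
      · rw [natCard_algEquiv_eq_of_isFractionRing R K L, hcard]
      · exact (forall_algEquiv_iff_of_isFractionRing (S := R) (K := K) (L := L)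
          (fun φ => ∀ y ∈ Algebra.adjoin R ({x} : Set L), φ y ∈ Algebra.adjoin R ({x} : Set L))).mpr
          hstab
  have hO : ∀ s : R, algebraMap R L s ∈ O := fun s => hRO s.2
  -- `x ∈ O`: valuation rings are integrally closed
  have hxO : x ∈ O := by
    letI : Algebra R O := ((algebraMap R L).codRestrict O.toSubring fun s => hO s).toAlgebra
    haveI : IsScalarTower R O L := IsScalarTower.of_algebraMap_eq fun _ => rfl
    have hint : IsIntegral R x := ⟨h, hmon, by rwa [← aeval_def]⟩
    obtain ⟨y, hy⟩ := IsIntegrallyClosed.algebraMap_eq_of_integral (IsIntegral.tower_top (A := O) hint)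
    rw [← hy]
    exact y.2
  have hadjO : ∀ (u : Set L), u ⊆ O → (Algebra.adjoin R u).toSubring ≤ O.toSubring := by
    intro u hu
    rw [Algebra.adjoin_eq_ring_closure]
    refine Subring.closure_le.mpr (Set.union_subset ?_ hu)
    rintro _ ⟨s, rfl⟩
    exact hO s
  -- the model `B = R[x] ⊆ O` and its centre `Q`
  have hB : (Algebra.adjoin R ({x} : Set L)).toSubring ≤ O.toSubring :=
    hadjO {x} (Set.singleton_subset_iff.mpr hxO)
  let Q : Ideal (Algebra.adjoin R ({x} : Set L)) :=
    subringCentre (Algebra.adjoin R ({x} : Set L)).toSubring O hB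
  haveI hQ : Q.IsPrime := subringCentre.isPrime _ O hB
  have h𝔞Q : maximalIdeal R ≤ Q.comap (algebraMap R (Algebra.adjoin R ({x} : Set L))) := by
    intro s hs
    rw [Ideal.mem_comap]
    change algebraMap R (Algebra.adjoin R ({x} : Set L)) s ∈
      subringCentre (Algebra.adjoin R ({x} : Set L)).toSubring O hB
    rw [mem_subringCentre_iff]
    exact hdom s hs
  by_cases hreg : IsRegularLocalRing (Localization.AtPrime Q)
  · -- nothing to do: `t = ∅`
    left
    have heq : (Algebra.adjoin R (insert x ((∅ : Finset L) : Set L))).toSubring =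
        (Algebra.adjoin R ({x} : Set L)).toSubring := by
      rw [Finset.coe_empty, ← Set.singleton_def]
    have hempty : (Algebra.adjoin R (insert x ((∅ : Finset L) : Set L))).toSubring ≤ O.toSubring :=
      heq ▸ hB
    exact ⟨∅, hempty, (isRegularLocalRing_centre_congr heq hempty hB).mpr hreg⟩
  right
  -- the centre is a singular point: `s₀ h ∈ 𝔑²`, `s₀ ∉ 𝔑`
  obtain ⟨s₀, hs₀, hs₀h⟩ :=
    Polynomial.Monic.exists_mul_mem_sq_of_not_isRegularLocalRing (K := K) hmon hirr hx Q h𝔞Q hreg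
  -- Prop. 2.10: `h ≡ (X - a)^p`, `𝔑 = (𝔪_R, X - a)`
  obtain ⟨a, hha, h𝔑a⟩ :=
    Polynomial.Monic.exists_map_eq_X_sub_C_pow_of_hypothesisG hp hmon hdeg hx hKx hG Q h𝔞Q hs₀ hs₀h
  refine ⟨a, (Polynomial.Monic.comp_X_add_C' hmon a).1,
    (Polynomial.Monic.comp_X_add_C' hmon a).2.trans hdeg, ?_, ?_, ?_, ?_, ?_, ?_, ?_⟩
  · -- root
    rw [show (a : L) = algebraMap R L a from rfl, Polynomial.aeval_sub_algebraMap_comp_X_add_C, hx]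
  · -- (MIN)
    intro g hgdeg hg
    have h1 : aeval x (taylor (-a) g) = 0 := by
      rw [taylor_apply, aeval_comp, map_add, aeval_X, aeval_C, map_neg]
      rw [show x + -(algebraMap R L a) = x - (a : L) from by rw [← sub_eq_add_neg]; rfl, hg]
    have h2 : taylor (-a) g = 0 := hmin _ (by rw [natDegree_taylor]; exact hgdeg) h1
    exact taylor_injective (-a) (by rw [h2, map_zero])
  · -- (GEN)
    intro z
    obtain ⟨g, s, hs, hz⟩ := hgen z
    refine ⟨g.comp (X + C a), s, hs, ?_⟩
    rw [show (a : L) = algebraMap R L a from rfl, Polynomial.aeval_sub_algebraMap_comp_X_add_C, hz]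
  · -- case (i) / (ii)
    rcases hcase with ⟨hL, hcoeff⟩ | ⟨hcard, hstab⟩
    · haveI : CharP K p := (RingHom.charP_iff_charP (algebraMap K L) p).mpr hL
      exact Or.inl ⟨hL, Polynomial.Monic.coeff_comp_X_add_C_eq_zero (K := K) hp hmon hdeg hcoeff a⟩
    · refine Or.inr ⟨hcard, ?_⟩
      rw [show (a : L) = algebraMap R L a from rfl, Algebra.adjoin_singleton_sub_algebraMap]
      exact hstab
  · -- normal form `h' ≡ X^p mod 𝔪_R`
    have hnf : (h.comp (X + C a)).map (Ideal.Quotient.mk (maximalIdeal R)) = X ^ p := by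
      rw [Polynomial.map_comp, hha, Polynomial.map_add, map_X, map_C, pow_comp, sub_comp,
        X_comp, C_comp, add_sub_cancel_right]
    intro i hi
    have h1 := congrArg (fun q : (R ⧸ maximalIdeal R)[X] => q.coeff i) hnf
    simp only [coeff_map, coeff_X_pow, if_neg hi.ne] at h1
    exact Ideal.Quotient.eq_zero_iff_mem.mp h1
  · -- `h'(0) ∈ 𝔪_R²`
    haveI : (Q.comap (aeval (R := R) (⟨x, Algebra.self_mem_adjoin_singleton R x⟩ :
        Algebra.adjoin R ({x} : Set L))).toRingHom).IsPrime := Ideal.comap_isPrime _ Q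
    have hmax : (Q.comap (aeval (R := R) (⟨x, Algebra.self_mem_adjoin_singleton R x⟩ :
        Algebra.adjoin R ({x} : Set L))).toRingHom).IsMaximal := by
      rw [h𝔑a]
      exact Polynomial.isMaximal_sup_span_X_sub_C (IsLocalRing.maximalIdeal.isMaximal R) a
    have hh2 := Ideal.IsMaximal.mem_pow_of_mul_mem_pow hmax hs₀ hs₀h
    rw [h𝔑a, Polynomial.mem_sup_span_X_sub_C_pow_iff] at hh2
    have := hh2 0
    rwa [Nat.sub_zero, taylor_apply] at this
  · -- the model is unchanged
    intro t
    rw [show (a : L) = algebraMap R L a from rfl, Algebra.adjoin_insert_sub_algebraMap]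

end Normalize

/-! ## The local theorem from the in-field statement in the two cases of Cor. 5.2 -/

/-- **The in-field local theorem from its two cases** (Cossart–Piltant, Cor. 5.2: "[Thm. 1.4]
is then an immediate consequence of [CoP4] Main Theorem 1.3 (`m(x) < p`), theorem 2.23
(`(m(x), ω(x)) = (p, 0)`) and theorem 5.1"): after normalisation at the frame
(`exists_regular_or_normalForm`) the centre is the singular rational point `X = 0` with
`h ≡ X^p mod 𝔪_R`, and `m(x) = ord_x h` is read off the coefficients —
`m(x) = p ⟺ (h)_i ∈ 𝔪_R^{p-i}` for all `i < p` (`ArithmeticalThreefoldsLocalProofs.lean`). So the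
in-field statement (hypothesis of `CossartPiltant2019Local.of_inField`) follows from its
restrictions to normal-form frames with (1) **`m(x) < p`**: some `(h)_i ∉ 𝔪_R^{p-i}` ([CoP4]
Main Thm. 1.3) and (2) **`m(x) = p`**: all `(h)_i ∈ 𝔪_R^{p-i}` (Ch. 2–9 of the paper).
[cite: CossartPiltant2019, Cor. 5.2 (arXiv v1 p. 58) and Prop. 2.10 (v1 pp. 15–16)] -/
theorem CossartPiltant2019Local.inField_of_cases
    (Hlt : ∀ (p : ℕ), p.Prime → ∀ (L : Type u) [Field L] (R : Subring L) [IsRegularLocalRing R],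
      IsExcellentRing R → ringKrullDim R = 3 → CharP (ResidueField R) p →
      ∀ (h : R[X]) (x : L), h.Monic → h.natDegree = p → aeval x h = 0 →
      (∀ g : R[X], g.natDegree < p → aeval x g = 0 → g = 0) →
      (∀ z : L, ∃ (g : R[X]) (s : R), s ≠ 0 ∧ z * s = aeval x g) →
      ((CharP L p ∧ ∀ i, 0 < i → i < p → h.coeff i = 0) ∨
        (Nat.card (L ≃ₐ[R] L) = p ∧
          ∀ σ : L ≃ₐ[R] L, ∀ y ∈ Algebra.adjoin R ({x} : Set L),
            σ y ∈ Algebra.adjoin R ({x} : Set L))) →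
      -- normal form, singular centre, `m(x) < p`:
      (∀ i < p, h.coeff i ∈ maximalIdeal R) → h.coeff 0 ∈ maximalIdeal R ^ 2 →
      (∃ i, i < p ∧ h.coeff i ∉ maximalIdeal R ^ (p - i)) →
      ∀ (O : ValuationSubring L), R ≤ O.toSubring →
        (∀ r : R, r ∈ maximalIdeal R → O.valuation (r : L) < 1) →
        ∃ (t : Finset L) (ht : (Algebra.adjoin R (insert x (t : Set L))).toSubring ≤ O.toSubring),
          IsRegularLocalRing (Localization.AtPrime
            (Ideal.comap (Subring.inclusion ht) (maximalIdeal O))))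
    (Heq : ∀ (p : ℕ), p.Prime → ∀ (L : Type u) [Field L] (R : Subring L) [IsRegularLocalRing R],
      IsExcellentRing R → ringKrullDim R = 3 → CharP (ResidueField R) p →
      ∀ (h : R[X]) (x : L), h.Monic → h.natDegree = p → aeval x h = 0 →
      (∀ g : R[X], g.natDegree < p → aeval x g = 0 → g = 0) →
      (∀ z : L, ∃ (g : R[X]) (s : R), s ≠ 0 ∧ z * s = aeval x g) →
      ((CharP L p ∧ ∀ i, 0 < i → i < p → h.coeff i = 0) ∨
        (Nat.card (L ≃ₐ[R] L) = p ∧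
          ∀ σ : L ≃ₐ[R] L, ∀ y ∈ Algebra.adjoin R ({x} : Set L),
            σ y ∈ Algebra.adjoin R ({x} : Set L))) →
      -- normal form with `m(x) = p` (`δ(x) ≥ 1`):
      (∀ i < p, h.coeff i ∈ maximalIdeal R ^ (p - i)) →
      ∀ (O : ValuationSubring L), R ≤ O.toSubring →
        (∀ r : R, r ∈ maximalIdeal R → O.valuation (r : L) < 1) →
        ∃ (t : Finset L) (ht : (Algebra.adjoin R (insert x (t : Set L))).toSubring ≤ O.toSubring),
          IsRegularLocalRing (Localization.AtPrime
            (Ideal.comap (Subring.inclusion ht) (maximalIdeal O)))) :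
    ∀ (p : ℕ), p.Prime → ∀ (L : Type u) [Field L] (R : Subring L) [IsRegularLocalRing R],
      IsExcellentRing R → ringKrullDim R = 3 → CharP (ResidueField R) p →
      ∀ (h : R[X]) (x : L), h.Monic → h.natDegree = p → aeval x h = 0 →
      (∀ g : R[X], g.natDegree < p → aeval x g = 0 → g = 0) →
      (∀ z : L, ∃ (g : R[X]) (s : R), s ≠ 0 ∧ z * s = aeval x g) →
      ((CharP L p ∧ ∀ i, 0 < i → i < p → h.coeff i = 0) ∨
        (Nat.card (L ≃ₐ[R] L) = p ∧
          ∀ σ : L ≃ₐ[R] L, ∀ y ∈ Algebra.adjoin R ({x} : Set L),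
            σ y ∈ Algebra.adjoin R ({x} : Set L))) →
      ∀ (O : ValuationSubring L), R ≤ O.toSubring →
        (∀ r : R, r ∈ maximalIdeal R → O.valuation (r : L) < 1) →
        ∃ (t : Finset L) (ht : (Algebra.adjoin R (insert x (t : Set L))).toSubring ≤ O.toSubring),
          IsRegularLocalRing (Localization.AtPrime
            (Ideal.comap (Subring.inclusion ht) (maximalIdeal O))) := by
  intro p hp L _ R _ hexc hdim hchar h x hmon hdeg hx hmin hgen hcase O hRO hdom
  rcases exists_regular_or_normalForm O hp hchar hRO hdom hmon hdeg hx hmin hgen hcase with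
    hreg | ⟨a, hmon', hdeg', hx', hmin', hgen', hcase', hnf, h0, hadj⟩
  · exact hreg
  · have key : ∃ (t : Finset L)
        (ht : (Algebra.adjoin R (insert (x - (a : L)) (t : Set L))).toSubring ≤ O.toSubring),
        IsRegularLocalRing (Localization.AtPrime
          (Ideal.comap (Subring.inclusion ht) (maximalIdeal O))) := by
      by_cases hm : ∀ i < p, (h.comp (X + C a)).coeff i ∈ maximalIdeal R ^ (p - i)
      · exact Heq p hp L R hexc hdim hchar _ _ hmon' hdeg' hx' hmin' hgen' hcase' hm O hRO hdom
      · push Not at hm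
        obtain ⟨i, hip, hi⟩ := hm
        exact Hlt p hp L R hexc hdim hchar _ _ hmon' hdeg' hx' hmin' hgen' hcase' hnf h0
          ⟨i, hip, hi⟩ O hRO hdom
    obtain ⟨t, ht, hregt⟩ := key
    have heq : (Algebra.adjoin R (insert (x - (a : L)) (t : Set L))).toSubring =
        (Algebra.adjoin R (insert x (t : Set L))).toSubring :=
      congrArg Subalgebra.toSubring (hadj (t : Set L))
    have ht' : (Algebra.adjoin R (insert x (t : Set L))).toSubring ≤ O.toSubring :=
      (le_of_eq heq.symm).trans ht
    exact ⟨t, ht', (isRegularLocalRing_centre_congr heq ht ht').mp hregt⟩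

/-- **`CossartPiltant2019Local` from the in-field statement in the two cases of Cor. 5.2**
(`CossartPiltant2019Local.of_inField` composed with `CossartPiltant2019Local.inField_of_cases`):
the named fact is reduced to in-field normal-form frames `(R ⊆ L, h, x, O)` with singular
rational centre, split as **`m(x) < p`** ([CoP4] Main Thm. 1.3) and **`m(x) = p`** (Thm. 2.23
and the Projection Theorem 5.1 of Cossart–Piltant 2019). These are the two open inputs.
[cite: CossartPiltant2019, Cor. 5.2 (arXiv v1 p. 58)] -/
theorem CossartPiltant2019Local.of_inField_cases
    (Hlt : ∀ (p : ℕ), p.Prime → ∀ (L : Type u) [Field L] (R : Subring L) [IsRegularLocalRing R],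
      IsExcellentRing R → ringKrullDim R = 3 → CharP (ResidueField R) p →
      ∀ (h : R[X]) (x : L), h.Monic → h.natDegree = p → aeval x h = 0 →
      (∀ g : R[X], g.natDegree < p → aeval x g = 0 → g = 0) →
      (∀ z : L, ∃ (g : R[X]) (s : R), s ≠ 0 ∧ z * s = aeval x g) →
      ((CharP L p ∧ ∀ i, 0 < i → i < p → h.coeff i = 0) ∨
        (Nat.card (L ≃ₐ[R] L) = p ∧
          ∀ σ : L ≃ₐ[R] L, ∀ y ∈ Algebra.adjoin R ({x} : Set L),
            σ y ∈ Algebra.adjoin R ({x} : Set L))) →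
      (∀ i < p, h.coeff i ∈ maximalIdeal R) → h.coeff 0 ∈ maximalIdeal R ^ 2 →
      (∃ i, i < p ∧ h.coeff i ∉ maximalIdeal R ^ (p - i)) →
      ∀ (O : ValuationSubring L), R ≤ O.toSubring →
        (∀ r : R, r ∈ maximalIdeal R → O.valuation (r : L) < 1) →
        ∃ (t : Finset L) (ht : (Algebra.adjoin R (insert x (t : Set L))).toSubring ≤ O.toSubring),
          IsRegularLocalRing (Localization.AtPrime
            (Ideal.comap (Subring.inclusion ht) (maximalIdeal O))))
    (Heq : ∀ (p : ℕ), p.Prime → ∀ (L : Type u) [Field L] (R : Subring L) [IsRegularLocalRing R],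
      IsExcellentRing R → ringKrullDim R = 3 → CharP (ResidueField R) p →
      ∀ (h : R[X]) (x : L), h.Monic → h.natDegree = p → aeval x h = 0 →
      (∀ g : R[X], g.natDegree < p → aeval x g = 0 → g = 0) →
      (∀ z : L, ∃ (g : R[X]) (s : R), s ≠ 0 ∧ z * s = aeval x g) →
      ((CharP L p ∧ ∀ i, 0 < i → i < p → h.coeff i = 0) ∨
        (Nat.card (L ≃ₐ[R] L) = p ∧
          ∀ σ : L ≃ₐ[R] L, ∀ y ∈ Algebra.adjoin R ({x} : Set L),
            σ y ∈ Algebra.adjoin R ({x} : Set L))) →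
      (∀ i < p, h.coeff i ∈ maximalIdeal R ^ (p - i)) →
      ∀ (O : ValuationSubring L), R ≤ O.toSubring →
        (∀ r : R, r ∈ maximalIdeal R → O.valuation (r : L) < 1) →
        ∃ (t : Finset L) (ht : (Algebra.adjoin R (insert x (t : Set L))).toSubring ≤ O.toSubring),
          IsRegularLocalRing (Localization.AtPrime
            (Ideal.comap (Subring.inclusion ht) (maximalIdeal O)))) :
    CossartPiltant2019Local.{u} :=
  CossartPiltant2019Local.of_inField (CossartPiltant2019Local.inField_of_cases Hlt Heq)


end Literature.AlgebraicGeometry.Resolution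

end
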